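import Summits.QuantumFields.YangMills.Theorems.UnitScaleTiltProp7TranslatedTubeFilling
import Summits.QuantumFields.YangMills.Theorems.LocalInsertionCombGaugeBox
import HarnessLib

/-!
# Route `UnitScaleTilt`, crux K1 «MinimiserStabilityRegPr» (stmt-QuantumFields-19200) — route-R E′ (A′)-comb, COMB-FLAT-COERCIVITY ⟸ (I3′); (I3′) organisation of record := PLAN B
# (px22 g5 LOCATE `LOCATE-I3-ONESTEP-px22g5.md` ac2baf06, adopted by the lane 05:54Z), FILE P1: **THE FIXED-SCALE LEMMA — a GRADIENT-BLIND linear functional of the bond fields of a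
# torus that only reads a non-wrapping BOX is bounded by the curl on that box**: `|e(Y)| ≤ W·(d·s)·max_{p ∈ box}|curl 1 Y p|` (hence `e(Y)² ≤ (W d s)²·Σ_{p∈box}(curl 1 Y p)²`),
# `W` = the functional's total variation, `s` = the box side — by the AXIAL GAUGE on the box (tree: direction `0`, then `1`, …) and abelian Stokes (this seat's F-c-1 one-leg move)

Cell `ym3-torus`, width seat `ym-ust-19200-w4` (gen 8; (I3′) LOCATE-first taker).  THEOREMS ONLY (0 `def`, 0 `sorry`); `--supports stmt-QuantumFields-19200`, count-neutral.  YM₃ on T³ is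
a ladder rung (R3), not the Clay problem; nothing here claims (I3′), COMB-FLAT-COERCIVITY, `norm_G₀ᶜ`, hcoS, E′, EX, the crux, d = 4 or the mass gap.

WHY (PLAN B §4).  The one-step defect `e_j = σ^{sh}_j − γ_j` of the telescope `ℓ·δQ̃ = Σ_j Πσ^{sh}_{>j} ∘ e_j ∘ T_j` is gradient-blind, constant-blind and supported in a box of side `≤ 2.5L+1`
at scale `L^j` (px22 §3; P2 = px21 g6).  The ONLY analytic input of (I3′) is then: such a functional is bounded by the curl energy of its box, with a constant depending on the box
side and the functional's total variation ONLY (no volume, no `ℓ`).  This file proves that, generically, for bond fields with values in ANY real normed space `V` on any torus `Site P j` (so `M₂(ℂ)` directly):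
axial potential `g(x) := Σ_μ Y[π_μ x; t_μ(x)·e_μ]` (`t(x)` = the offsets of `x` from the box corner `x₀`, `π_μ x` = `x` with the coordinates `≥ μ` reset to `x₀`'s), `Z := Y − dg`;
then `e(Y) = e(Z)` (blindness), `Z` vanishes on tree bonds and on an off-tree box bond `⟨x, μ⟩` equals a signed sum of `≤ Σ_{ν>μ} t_ν(x) ≤ d·s` unit plaquette circulations inside the box
(F-c-1 ✓`segSum_transl_leg` with a unit translation, telescoped over the directions `ν > μ`), so `|Z| ≤ d·s·max_box|curl 1 Y|` on the box and `|e(Z)| ≤ W·d·s·max|curl|`.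

WHAT IS PROVED (ns `…Theorems.Prop7GradBlindLocalCurlBound`; torus `Site P j = Fin P.d → ZMod (P.sitesPerDir j)`, box = `{x : ∀ μ, (x μ − x₀ μ).val < s}`, `s + 1 ≤ P.sitesPerDir j`):
§1 the axial projections `π` (box offsets: ★w3-19936 g11 ✓`LocalInsertion.CombGauge.offset_shift_self∕_of_ne`, imported); §2 the axial potential's gradient on box bonds (`grad_axial_eq`); §3 ★★★`norm_le_of_gradBlind_local` (sup form) and ★★★`normSq_le_of_gradBlind_local`
(`ℓ²` form over the box plaquettes `{p : ∀ μ, (p.src μ − x₀ μ).val < s}`), both `V`-GENERIC (`Y : PBond P j → V`, `e : (PBond P j → V) →ₗ[ℝ] W`, normed real spaces); §4 `sup_control_of_weights`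
((hW) for an explicitly weighted `e`, `Wt = Σ|w|`).
HONEST SCOPE: a generic lattice lemma; nothing of `e_j`, the telescope, (I3′), COMB-FLAT or A6ᶜ is touched.  Rung R3, not Clay; YM gap NOT proved.

References: T. Bałaban, CMP 95 (1984) 17–40 [Balaban1984PropagatorsI] ((1.7)–(1.9) p.19: straight contours, the rectangle identity; (1.4): gauge `A ↦ A − dλ`); CMP 99 (1985) 389–434
[Balaban1985BackgroundPropagators] (Thm 3.11 p.416: the coercivity this serves); CMP 98 (1985) 17–51 [Balaban1985Averaging] ((19)–(21) p.20: axial gauge on a block).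
-/

noncomputable section

open scoped BigOperators

namespace Summit.QuantumFields.YangMills.Theorems.Prop7GradBlindLocalCurlBound

open Literature.MathematicalPhysics.QuantumFieldTheory.Balaban1983to89
open T4Continuum LatticeFieldCalculus
open B5Eq118OneStroke (runSite_add segSum_add)
open Summit.QuantumFields.YangMills.Theorems.Prop7TranslatedTubeFilling (runSite_one_eq_shift segSum_transl_leg plaqCirc_eq_curl plaqCirc_eq_neg_curl)

variable {P : Params} {j : ℕ}

/-! ## §1 Offsets from the corner and the axial projections -/

/-- The axial projection `π_k x` (coordinates `< k` from `x`, the rest from `x₀`) commutes with `+e_μ` when `μ < k` … [cite: Balaban1985Averaging, (19) p.20] -/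
theorem proj_shift_of_lt (x₀ x : Site P j) {μ : Fin P.d} {k : ℕ} (h : μ.val < k) :
    (fun ν : Fin P.d => if ν.val < k then (x.shift μ) ν else x₀ ν) = Site.shift (fun ν : Fin P.d => if ν.val < k then x ν else x₀ ν) μ := by
  funext ν
  by_cases hν : ν = μ
  · subst hν; simp [Site.shift, h]
  · simp [Site.shift, Function.update_of_ne hν]

/-- … and ignores `+e_μ` when `k ≤ μ`. [cite: Balaban1985Averaging, (19) p.20] -/
theorem proj_shift_of_le (x₀ x : Site P j) {μ : Fin P.d} {k : ℕ} (h : k ≤ μ.val) :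
    (fun ν : Fin P.d => if ν.val < k then (x.shift μ) ν else x₀ ν) = (fun ν : Fin P.d => if ν.val < k then x ν else x₀ ν) := by
  funext ν
  by_cases hν : ν = μ
  · subst hν; simp [show ¬ ν.val < k from by omega]
  · simp [Site.shift, Function.update_of_ne hν]

/-- Running from `π_k x` along `e_μ` (`k = μ`) by the `μ`-offset of `x` reaches `π_{k+1} x`. [cite: Balaban1984PropagatorsI, (1.7) p.19] -/
theorem runSite_proj (x₀ x : Site P j) (μ : Fin P.d) :
    runSite (fun ν : Fin P.d => if ν.val < μ.val then x ν else x₀ ν) μ (x μ - x₀ μ).val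
      = (fun ν : Fin P.d => if ν.val < μ.val + 1 then x ν else x₀ ν) := by
  funext ν
  by_cases hν : ν = μ
  · subst hν
    simp [runSite]
  · have hne : ν.val ≠ μ.val := fun h => hν (Fin.ext h)
    simp only [runSite, Function.update_of_ne hν]
    by_cases h1 : ν.val < μ.val
    · simp [h1, show ν.val < μ.val + 1 by omega]
    · simp [h1, show ¬ ν.val < μ.val + 1 by omega]

/-- All coordinates from `x`: `π_d x = x`. [folklore] -/
theorem proj_top (x₀ x : Site P j) : (fun ν : Fin P.d => if ν.val < P.d then x ν else x₀ ν) = x := by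
  funext ν; simp [ν.isLt]

/-! ## §2 The axial potential and its gradient on box bonds -/

section Axial

variable {V : Type*} [AddCommGroup V]

/-- Direction `ν` BELOW `μ`: the `ν`-leg of the axial path is unchanged under `x ↦ x + e_μ`. [cite: Balaban1985Averaging, (19)–(21) p.20] -/
theorem axialLeg_shift_of_lt (Y : PBond P j → V) (x₀ x : Site P j) {μ ν : Fin P.d} (h : ν.val < μ.val) :
    segSum Y (fun κ : Fin P.d => if κ.val < ν.val then (x.shift μ) κ else x₀ κ) ν (((x.shift μ) ν - x₀ ν).val)
      = segSum Y (fun κ : Fin P.d => if κ.val < ν.val then x κ else x₀ κ) ν ((x ν - x₀ ν).val) := by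
  have hne : ν ≠ μ := fun h' => by subst h'; exact lt_irrefl _ h
  rw [proj_shift_of_le x₀ x h.le, LocalInsertion.CombGauge.offset_shift_of_ne x₀ x hne]

/-- Direction `μ` ITSELF: the `μ`-leg grows by the one bond `⟨π_{μ+1} x, μ⟩`. [cite: Balaban1985Averaging, (19)–(21) p.20] -/
theorem axialLeg_shift_self (Y : PBond P j → V) (x₀ x : Site P j) (μ : Fin P.d) (hwrap : (x μ - x₀ μ).val + 1 < P.sitesPerDir j) :
    segSum Y (fun κ : Fin P.d => if κ.val < μ.val then (x.shift μ) κ else x₀ κ) μ (((x.shift μ) μ - x₀ μ).val)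
      = segSum Y (fun κ : Fin P.d => if κ.val < μ.val then x κ else x₀ κ) μ ((x μ - x₀ μ).val)
        + Y ⟨(fun κ : Fin P.d => if κ.val < μ.val + 1 then x κ else x₀ κ), μ⟩ := by
  rw [proj_shift_of_le x₀ x le_rfl, LocalInsertion.CombGauge.offset_shift_self x₀ x μ hwrap, LinAvgFluxExact.segSum_succ, runBond, runSite_proj]

/-- Direction `ν` ABOVE `μ`: the `ν`-leg is translated by `e_μ` — F-c-1's one-leg move with a unit translation: end connector minus start connector minus the `t_ν × 1` strip.
[cite: Balaban1984PropagatorsI, (1.9) p.19] -/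
theorem axialLeg_shift_of_gt (Y : PBond P j → V) (x₀ x : Site P j) {μ ν : Fin P.d} (h : μ.val < ν.val) :
    segSum Y (fun κ : Fin P.d => if κ.val < ν.val then (x.shift μ) κ else x₀ κ) ν (((x.shift μ) ν - x₀ ν).val)
      = segSum Y (fun κ : Fin P.d => if κ.val < ν.val then x κ else x₀ κ) ν ((x ν - x₀ ν).val)
        + (Y ⟨(fun κ : Fin P.d => if κ.val < ν.val + 1 then x κ else x₀ κ), μ⟩ - Y ⟨(fun κ : Fin P.d => if κ.val < ν.val then x κ else x₀ κ), μ⟩)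
        - ∑ s ∈ Finset.range ((x ν - x₀ ν).val),
            (Y ⟨runSite (fun κ : Fin P.d => if κ.val < ν.val then x κ else x₀ κ) ν s, ν⟩
              + Y ⟨runSite (runSite (fun κ : Fin P.d => if κ.val < ν.val then x κ else x₀ κ) ν s) ν 1, μ⟩
              - Y ⟨runSite (runSite (fun κ : Fin P.d => if κ.val < ν.val then x κ else x₀ κ) ν s) μ 1, ν⟩
              - Y ⟨runSite (fun κ : Fin P.d => if κ.val < ν.val then x κ else x₀ κ) ν s, μ⟩) := by
  have hne : ν ≠ μ := fun h' => by subst h'; exact lt_irrefl _ h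
  rw [proj_shift_of_lt x₀ x h, LocalInsertion.CombGauge.offset_shift_of_ne x₀ x hne, ← runSite_one_eq_shift]
  have h1 := segSum_transl_leg Y (fun κ : Fin P.d => if κ.val < ν.val then x κ else x₀ κ) ν μ ((x ν - x₀ ν).val) 1
  rw [sub_eq_iff_eq_add'] at h1
  rw [h1, LinAvgFluxExact.segSum_one, LinAvgFluxExact.segSum_one, runSite_proj]
  simp only [Finset.range_one, Finset.sum_singleton, runSite_zero]
  abel

/-- Telescoping over the directions above `μ`: `Σ_{ν : μ < ν} (f(ν+1) − f(ν)) = f(d) − f(μ+1)`. [folklore] -/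
theorem sum_ite_lt_sub_telescope (f : ℕ → V) (μ : Fin P.d) :
    ∑ ν : Fin P.d, (if μ.val < ν.val then f (ν.val + 1) - f ν.val else 0) = f P.d - f (μ.val + 1) := by
  rw [Fin.sum_univ_eq_sum_range (fun k => if μ.val < k then f (k + 1) - f k else 0) P.d]
  have hμ : μ.val + 1 ≤ P.d := μ.isLt
  rw [← Finset.sum_range_add_sum_Ico _ hμ]
  have h0 : ∑ k ∈ Finset.range (μ.val + 1), (if μ.val < k then f (k + 1) - f k else 0) = 0 :=
    Finset.sum_eq_zero fun k hk => by rw [if_neg (by simp at hk; omega)]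
  have h1 : ∑ k ∈ Finset.Ico (μ.val + 1) P.d, (if μ.val < k then f (k + 1) - f k else 0)
      = ∑ k ∈ Finset.Ico (μ.val + 1) P.d, (f (k + 1) - f k) :=
    Finset.sum_congr rfl fun k hk => by rw [if_pos (by simp at hk; omega)]
  rw [h0, zero_add, h1, Finset.sum_Ico_eq_sum_range]
  have htel : ∀ m : ℕ, ∑ i ∈ Finset.range m, (f (μ.val + 1 + i + 1) - f (μ.val + 1 + i)) = f (μ.val + 1 + m) - f (μ.val + 1) := by
    intro m
    induction m with
    | zero => simp
    | succ m ih => rw [Finset.sum_range_succ, ih]; rw [show μ.val + 1 + (m + 1) = μ.val + 1 + m + 1 by ring]; abel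
  rw [htel, show μ.val + 1 + (P.d - (μ.val + 1)) = P.d by omega]

/-- ★★ **THE GRADIENT OF THE AXIAL POTENTIAL ON A BOX BOND.**  With `g(x) := Σ_ν Y[π_ν x; t_ν(x)·e_ν]` (the axial tree from the corner `x₀`: direction `0` first, then `1`, …;
`t_ν(x) = (x ν − x₀ ν).val`, `π_ν x` = `x` with the coordinates `≥ ν` reset to `x₀`'s), for every bond `⟨x, μ⟩` whose `μ`-offset does not wrap:
`g(x + e_μ) − g(x) = Y⟨x, μ⟩ − Σ_{ν > μ} Σ_{s < t_ν(x)} (unit plaquette circulation at `π_ν x + s e_ν` in the plane `(ν, μ)`)` — the bond variable minus the circulation of `Y` around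
the axial loop of the bond, written as a sum of unit plaquettes (tree bonds: empty sum). [cite: Balaban1985Averaging, (19)–(21) p.20; Balaban1984PropagatorsI, (1.9) p.19] -/
theorem grad_axial_eq (Y : PBond P j → V) (x₀ x : Site P j) (μ : Fin P.d) (hwrap : (x μ - x₀ μ).val + 1 < P.sitesPerDir j) :
    (∑ ν : Fin P.d, segSum Y (fun κ : Fin P.d => if κ.val < ν.val then (x.shift μ) κ else x₀ κ) ν (((x.shift μ) ν - x₀ ν).val))
      - (∑ ν : Fin P.d, segSum Y (fun κ : Fin P.d => if κ.val < ν.val then x κ else x₀ κ) ν ((x ν - x₀ ν).val))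
      = Y ⟨x, μ⟩
        - ∑ ν : Fin P.d, (if μ.val < ν.val then
            ∑ s ∈ Finset.range ((x ν - x₀ ν).val),
              (Y ⟨runSite (fun κ : Fin P.d => if κ.val < ν.val then x κ else x₀ κ) ν s, ν⟩
                + Y ⟨runSite (runSite (fun κ : Fin P.d => if κ.val < ν.val then x κ else x₀ κ) ν s) ν 1, μ⟩
                - Y ⟨runSite (runSite (fun κ : Fin P.d => if κ.val < ν.val then x κ else x₀ κ) ν s) μ 1, ν⟩
                - Y ⟨runSite (fun κ : Fin P.d => if κ.val < ν.val then x κ else x₀ κ) ν s, μ⟩)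
          else 0) := by
  rw [← Finset.sum_sub_distrib]
  -- per direction
  have hterm : ∀ ν : Fin P.d,
      segSum Y (fun κ : Fin P.d => if κ.val < ν.val then (x.shift μ) κ else x₀ κ) ν (((x.shift μ) ν - x₀ ν).val)
        - segSum Y (fun κ : Fin P.d => if κ.val < ν.val then x κ else x₀ κ) ν ((x ν - x₀ ν).val)
      = (if ν = μ then Y ⟨(fun κ : Fin P.d => if κ.val < μ.val + 1 then x κ else x₀ κ), μ⟩ else 0)
        + (if μ.val < ν.val then
            (Y ⟨(fun κ : Fin P.d => if κ.val < ν.val + 1 then x κ else x₀ κ), μ⟩ - Y ⟨(fun κ : Fin P.d => if κ.val < ν.val then x κ else x₀ κ), μ⟩)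
           else 0)
        - (if μ.val < ν.val then
            ∑ s ∈ Finset.range ((x ν - x₀ ν).val),
              (Y ⟨runSite (fun κ : Fin P.d => if κ.val < ν.val then x κ else x₀ κ) ν s, ν⟩
                + Y ⟨runSite (runSite (fun κ : Fin P.d => if κ.val < ν.val then x κ else x₀ κ) ν s) ν 1, μ⟩
                - Y ⟨runSite (runSite (fun κ : Fin P.d => if κ.val < ν.val then x κ else x₀ κ) ν s) μ 1, ν⟩
                - Y ⟨runSite (fun κ : Fin P.d => if κ.val < ν.val then x κ else x₀ κ) ν s, μ⟩)
          else 0) := by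
    intro ν
    rcases lt_trichotomy ν.val μ.val with h | h | h
    · have hne : ν ≠ μ := fun h' => by subst h'; exact lt_irrefl _ h
      rw [axialLeg_shift_of_lt Y x₀ x h, if_neg hne, if_neg (by omega), if_neg (by omega)]
      abel
    · have heq : ν = μ := Fin.ext h
      subst heq
      rw [axialLeg_shift_self Y x₀ x ν hwrap, if_pos rfl, if_neg (lt_irrefl _), if_neg (lt_irrefl _)]
      abel
    · have hne : ν ≠ μ := fun h' => by subst h'; exact lt_irrefl _ h
      rw [axialLeg_shift_of_gt Y x₀ x h, if_neg hne, if_pos h, if_pos h]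
      abel
  rw [Finset.sum_congr rfl fun ν _ => hterm ν, Finset.sum_sub_distrib, Finset.sum_add_distrib, Finset.sum_ite_eq' Finset.univ μ, if_pos (Finset.mem_univ μ),
    sum_ite_lt_sub_telescope (fun k => Y ⟨(fun κ : Fin P.d => if κ.val < k then x κ else x₀ κ), μ⟩) μ, proj_top]
  abel

end Axial

/-! ## §3 The fixed-scale lemma -/

section Main

/-- The sites met by the axial loops of a box bond stay in the box: for `x` in the box and `s' < t_ν(x)`, every offset of `π_ν x + s'e_ν` is `< s`.
[cite: Balaban1985Averaging, (19)–(21) p.20] -/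
theorem runSite_proj_mem_box (x₀ x : Site P j) {s : ℕ} (hs : s + 1 ≤ P.sitesPerDir j) (hx : ∀ κ : Fin P.d, (x κ - x₀ κ).val < s)
    (ν : Fin P.d) {s' : ℕ} (hs' : s' < (x ν - x₀ ν).val) (κ : Fin P.d) :
    ((runSite (fun κ' : Fin P.d => if κ'.val < ν.val then x κ' else x₀ κ') ν s') κ - x₀ κ).val < s := by
  by_cases hκ : κ = ν
  · subst hκ
    have hlt : s' < s := lt_trans hs' (hx κ)
    have : ((runSite (fun κ' : Fin P.d => if κ'.val < κ.val then x κ' else x₀ κ') κ s') κ - x₀ κ) = (s' : ZMod (P.sitesPerDir j)) := by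
      simp [runSite]
    rw [this, ZMod.val_natCast_of_lt (by omega)]
    exact hlt
  · simp only [runSite, Function.update_of_ne hκ]
    by_cases h1 : κ.val < ν.val
    · rw [if_pos h1]; exact hx κ
    · rw [if_neg h1, sub_self, ZMod.val_zero]
      exact lt_of_le_of_lt (Nat.zero_le s') (lt_trans hs' (hx ν))

variable {V W : Type*} [NormedAddCommGroup V] [NormedSpace ℝ V] [NormedAddCommGroup W] [NormedSpace ℝ W]

/-- ★★★ **THE FIXED-SCALE LEMMA (sup form), `V`-GENERIC.**  Let `e` be a real-linear map from the `V`-valued bond fields of the torus `Site P j` to a normed space `W` which (hW) is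
controlled by the values on the bonds issued from the box `{x : ∀ μ, (x μ − x₀ μ).val < s}` with total variation `Wt` (`‖e Y‖ ≤ Wt·M` whenever `‖Y‖ ≤ M` on those bonds), and (hblind)
kills every gradient.  If the box does not wrap (`s + 1 ≤` the torus side), then for every `Y` whose plaquette variables on the box plaquettes have norm `≤ C`: **`‖e Y‖ ≤ Wt·(d·s·C)`**.
Proof: axial gauge (§2) — `e(Y) = e(Y − dg)`, and `Y − dg` is, bond by bond on the box, a signed sum of `≤ d·s` box plaquette variables.
[cite: Balaban1985Averaging, (19)–(21) p.20; Balaban1984PropagatorsI, (1.4) p.18, (1.9) p.19] -/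
theorem norm_le_of_gradBlind_local (e : (PBond P j → V) →ₗ[ℝ] W) (x₀ : Site P j) {s : ℕ} (hs : s + 1 ≤ P.sitesPerDir j) {Wt : ℝ}
    (hW : ∀ (Y : PBond P j → V) (M : ℝ), (∀ b : PBond P j, (∀ μ, (b.src μ - x₀ μ).val < s) → ‖Y b‖ ≤ M) → ‖e Y‖ ≤ Wt * M)
    (hblind : ∀ g : Site P j → V, e (fun b => g b.tgt - g b.src) = 0)
    (Y : PBond P j → V) {C : ℝ} (hC0 : 0 ≤ C) (hC : ∀ p : Plaq P j, (∀ μ, (p.src μ - x₀ μ).val < s) → ‖curl 1 Y p‖ ≤ C) :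
    ‖e Y‖ ≤ Wt * ((P.d : ℝ) * s * C) := by
  -- the axial potential and the gauged field
  set g : Site P j → V := fun x => ∑ ν : Fin P.d, segSum Y (fun κ : Fin P.d => if κ.val < ν.val then x κ else x₀ κ) ν ((x ν - x₀ ν).val) with hg
  set Z : PBond P j → V := fun b => Y b - (g b.tgt - g b.src) with hZ
  have hY : Y = Z + fun b => g b.tgt - g b.src := by funext b; simp [hZ]
  have heY : e Y = e Z := by rw [hY, map_add, hblind, add_zero]
  rw [heY]
  refine hW Z _ fun b hb => ?_
  -- a box bond `b = ⟨x, μ⟩`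
  obtain ⟨x, μ⟩ := b
  have hx : ∀ κ : Fin P.d, (x κ - x₀ κ).val < s := hb
  have hwrap : (x μ - x₀ μ).val + 1 < P.sitesPerDir j := by have := hx μ; omega
  have hZb : Z ⟨x, μ⟩ = Y ⟨x, μ⟩ - (g (x.shift μ) - g x) := by simp [hZ, PBond.tgt]
  rw [hZb, hg]
  simp only []
  rw [grad_axial_eq Y x₀ x μ hwrap, sub_sub_cancel]
  -- bound the double sum of plaquette circulations
  calc ‖∑ ν : Fin P.d, (if μ.val < ν.val then
            ∑ s' ∈ Finset.range ((x ν - x₀ ν).val),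
              (Y ⟨runSite (fun κ : Fin P.d => if κ.val < ν.val then x κ else x₀ κ) ν s', ν⟩
                + Y ⟨runSite (runSite (fun κ : Fin P.d => if κ.val < ν.val then x κ else x₀ κ) ν s') ν 1, μ⟩
                - Y ⟨runSite (runSite (fun κ : Fin P.d => if κ.val < ν.val then x κ else x₀ κ) ν s') μ 1, ν⟩
                - Y ⟨runSite (fun κ : Fin P.d => if κ.val < ν.val then x κ else x₀ κ) ν s', μ⟩)
          else 0)‖
      ≤ ∑ ν : Fin P.d, ‖(if μ.val < ν.val then
            ∑ s' ∈ Finset.range ((x ν - x₀ ν).val),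
              (Y ⟨runSite (fun κ : Fin P.d => if κ.val < ν.val then x κ else x₀ κ) ν s', ν⟩
                + Y ⟨runSite (runSite (fun κ : Fin P.d => if κ.val < ν.val then x κ else x₀ κ) ν s') ν 1, μ⟩
                - Y ⟨runSite (runSite (fun κ : Fin P.d => if κ.val < ν.val then x κ else x₀ κ) ν s') μ 1, ν⟩
                - Y ⟨runSite (fun κ : Fin P.d => if κ.val < ν.val then x κ else x₀ κ) ν s', μ⟩)
          else 0)‖ := norm_sum_le _ _
    _ ≤ ∑ _ν : Fin P.d, (s : ℝ) * C := by
        refine Finset.sum_le_sum fun ν _ => ?_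
        by_cases hμν : μ.val < ν.val
        · rw [if_pos hμν]
          have hlt : μ < ν := hμν
          calc ‖∑ s' ∈ Finset.range ((x ν - x₀ ν).val),
                  (Y ⟨runSite (fun κ : Fin P.d => if κ.val < ν.val then x κ else x₀ κ) ν s', ν⟩
                    + Y ⟨runSite (runSite (fun κ : Fin P.d => if κ.val < ν.val then x κ else x₀ κ) ν s') ν 1, μ⟩
                    - Y ⟨runSite (runSite (fun κ : Fin P.d => if κ.val < ν.val then x κ else x₀ κ) ν s') μ 1, ν⟩
                    - Y ⟨runSite (fun κ : Fin P.d => if κ.val < ν.val then x κ else x₀ κ) ν s', μ⟩)‖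
              ≤ ∑ s' ∈ Finset.range ((x ν - x₀ ν).val),
                  ‖Y ⟨runSite (fun κ : Fin P.d => if κ.val < ν.val then x κ else x₀ κ) ν s', ν⟩
                    + Y ⟨runSite (runSite (fun κ : Fin P.d => if κ.val < ν.val then x κ else x₀ κ) ν s') ν 1, μ⟩
                    - Y ⟨runSite (runSite (fun κ : Fin P.d => if κ.val < ν.val then x κ else x₀ κ) ν s') μ 1, ν⟩
                    - Y ⟨runSite (fun κ : Fin P.d => if κ.val < ν.val then x κ else x₀ κ) ν s', μ⟩‖ := norm_sum_le _ _
            _ ≤ ∑ _s' ∈ Finset.range ((x ν - x₀ ν).val), C := by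
                refine Finset.sum_le_sum fun s' hs' => ?_
                rw [Finset.mem_range] at hs'
                rw [plaqCirc_eq_neg_curl Y _ hlt, norm_neg]
                exact hC _ (runSite_proj_mem_box x₀ x hs hx ν hs')
            _ = ((x ν - x₀ ν).val : ℝ) * C := by rw [Finset.sum_const, Finset.card_range, nsmul_eq_mul]
            _ ≤ (s : ℝ) * C := mul_le_mul_of_nonneg_right (by exact_mod_cast (hx ν).le) hC0
        · rw [if_neg hμν, norm_zero]; positivity
    _ = (P.d : ℝ) * s * C := by rw [Finset.sum_const, Finset.card_univ, Fintype.card_fin, nsmul_eq_mul, mul_assoc]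

/-- ★★★ **THE FIXED-SCALE LEMMA (`ℓ²` form)**: under the same hypotheses, `‖e Y‖² ≤ (Wt·d·s)²·Σ_{p : box plaquette} ‖curl 1 Y p‖²`, the box plaquettes being those whose
base site has all offsets `< s` (their far corners may stick out by one, harmlessly).  THIS is PLAN B's `|e_j(Y)|² ≤ K·Σ_{box}|d_jY|²` with `K = (Wt·d·s)²` — L-only once `s, Wt` are.
[cite: Balaban1985Averaging, (19)–(21) p.20; Balaban1985BackgroundPropagators, Thm 3.11 p.416] -/
theorem normSq_le_of_gradBlind_local (e : (PBond P j → V) →ₗ[ℝ] W) (x₀ : Site P j) {s : ℕ} (hs : s + 1 ≤ P.sitesPerDir j) {Wt : ℝ}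
    (hW : ∀ (Y : PBond P j → V) (M : ℝ), (∀ b : PBond P j, (∀ μ, (b.src μ - x₀ μ).val < s) → ‖Y b‖ ≤ M) → ‖e Y‖ ≤ Wt * M)
    (hblind : ∀ g : Site P j → V, e (fun b => g b.tgt - g b.src) = 0)
    (Y : PBond P j → V) :
    ‖e Y‖ ^ 2 ≤ (Wt * ((P.d : ℝ) * s)) ^ 2 * ∑ p ∈ Finset.univ.filter (fun p : Plaq P j => ∀ μ, (p.src μ - x₀ μ).val < s), ‖curl 1 Y p‖ ^ 2 := by
  set E : ℝ := ∑ p ∈ Finset.univ.filter (fun p : Plaq P j => ∀ μ, (p.src μ - x₀ μ).val < s), ‖curl 1 Y p‖ ^ 2 with hE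
  have hE0 : 0 ≤ E := Finset.sum_nonneg fun p _ => sq_nonneg _
  have hC : ∀ p : Plaq P j, (∀ μ, (p.src μ - x₀ μ).val < s) → ‖curl 1 Y p‖ ≤ Real.sqrt E := fun p hp => by
    rw [← Real.sqrt_sq (norm_nonneg (curl 1 Y p))]
    exact Real.sqrt_le_sqrt (Finset.single_le_sum (f := fun p : Plaq P j => ‖curl 1 Y p‖ ^ 2) (fun q _ => sq_nonneg _) (Finset.mem_filter.2 ⟨Finset.mem_univ p, hp⟩))
  have h1 := norm_le_of_gradBlind_local e x₀ hs hW hblind Y (Real.sqrt_nonneg E) hC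
  calc ‖e Y‖ ^ 2 ≤ (Wt * ((P.d : ℝ) * s * Real.sqrt E)) ^ 2 := pow_le_pow_left₀ (norm_nonneg _) h1 2
    _ = (Wt * ((P.d : ℝ) * s)) ^ 2 * E := by
        rw [show Wt * ((P.d : ℝ) * s * Real.sqrt E) = Wt * ((P.d : ℝ) * s) * Real.sqrt E by ring, mul_pow, Real.sq_sqrt hE0]

/-! ## §4 Discharging (hW) for an explicitly weighted functional -/

/-- **(hW) FROM EXPLICIT WEIGHTS**: if `e Y = Σ_{b ∈ B} w b • Y b` with every `b ∈ B` issued from the box, then `e` is sup-controlled over the box bonds with total variation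
`Wt := Σ_{b∈B} |w b|` — the form in which P2's one-step defect `e_j` (explicit tube∕leg weights, mass `≤ 8L`) meets `norm_le_of_gradBlind_local`. [cite: Balaban1984PropagatorsI, (1.8) p.19] -/
theorem sup_control_of_weights (B : Finset (PBond P j)) (w : PBond P j → ℝ) (x₀ : Site P j) (s : ℕ)
    (hB : ∀ b ∈ B, ∀ μ, (b.src μ - x₀ μ).val < s) (e : (PBond P j → V) →ₗ[ℝ] V) (he : ∀ Y, e Y = ∑ b ∈ B, w b • Y b)
    (Y : PBond P j → V) (M : ℝ) (hM : ∀ b : PBond P j, (∀ μ, (b.src μ - x₀ μ).val < s) → ‖Y b‖ ≤ M) :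
    ‖e Y‖ ≤ (∑ b ∈ B, |w b|) * M := by
  rw [he, Finset.sum_mul]
  refine (norm_sum_le _ _).trans (Finset.sum_le_sum fun b hb => ?_)
  rw [norm_smul, Real.norm_eq_abs]
  exact mul_le_mul_of_nonneg_left (hM b (hB b hb)) (abs_nonneg _)

end Main

end Summit.QuantumFields.YangMills.Theorems.Prop7GradBlindLocalCurlBound

end
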